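import Summits.QuantumFields.YangMills.Theses.DirichletWindow

/-!
# Birth skeleton (BC3) for crux `WindowReduction` (stmt-QuantumFields-12317) — `Lines/birth.lean`

Registrar: `planner-skel-stmt-QuantumFields-12317-0` (skeleton-register one-shot; route
`route-QuantumFields-DirichletWindow`, re-audit bin REPAIRABLE), 2026-08-17.

Crux (route file `Theses/DirichletWindow.lean`, decl
`Summit.QuantumFields.YangMills.Theses.DirichletWindow.WindowReduction`, rank 5, [M] "DLR window glue"):
`FreeEnergyLogCoefficient → BoxLaplace → BackgroundBudget → LocalGaussianity`, where
`LocalGaussianity` is (definitionally) the conjunction of the bodies of `FixedDistanceLower`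
(`f_β(ne₀) ≥ A/(β²n⁸)`) and `PlaquetteVarianceUpper` (`f_β(0) ≤ B/β²`), uniformly over ALL torus-limit
states `μ ∈ infiniteVolumeLimitPoints r.ρ β`.

## Standing analysis honoured (item evidence, 2026-08-15)

Refuter `rattack-12317` (EVIDENCE.md, toy_gap.py, W.lean, W2.lean: verdict refuted-MISSTATED, repair C′),
route review `rreview-0815T18-27` (stamp WITH CAVEAT) and grounder `g27-20` agree: the implication is
true-as-expected but NOT closable from its three hypotheses by the advertised bookkeeping — swapping
Wilson's raw DLR kernel `γ_ω = ymSpecification r.ρ β Λ ω` for the good-conditioned kernel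
`ν_ω = γ_ω(· | good)` inside `E_μ` costs `2‖F‖∞ · E_μ[γ_ω(goodᶜ)] = 2‖F‖∞ · μ(goodᶜ)`, and NO hypothesis
exports `μ(goodᶜ) = O(δ/β²)` uniformly over limit states (`BackgroundBudget` (c) bounds only
`μ{ω | γ_ω(good) < 1/2}`; schematic counter-model toy_gap.py: every hypothesis-shaped quantity
β-uniform, `μ(bad) = 1/4`, `Cov_μ → −1/16`). This skeleton types exactly that missing export as its
load-bearing new stub (R) — the refuter's repaired conjunct (c′) as a free-standing statement — and cuts
the rest of the crux along its genuine seams: the DLR disintegration toolkit (T) that both halves of the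
bookkeeping consume, and the two halves themselves (L: fixed-distance lower bound; U: variance upper
bound), each stated GIVEN (T) and (R). Composition = pure logic (`LocalGaussianity` is the conjunction).

## The four stubs

* `stub_dlrDisintegration` (T; S–M, provable now) — for every torus-limit state `μ` at `β` and every
  finite edge set `Λ`: the kernels `γ_Λ(· | ω)` are probability measures; set-DLR `∫ γ_Λ(A|ω) dμ = μ A`
  with `ω ↦ γ_Λ(A|ω)` measurable; function-DLR `∫∫ F dγ_Λ(·|ω) dμ = ∫ F dμ` with `ω ↦ ∫ F dγ_Λ(·|ω)`
  measurable, for bounded measurable real `F`. Leans on (all in tree):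
  `mem_ymGibbsMeasures_of_mem_infiniteVolumeLimitPoints_holds`, `isSpecification_ymSpecification_t2_holds`,
  `IsSpecification.toKernel` / `isMarkovKernel_toKernel`, `cylinderEvents_le_pi`,
  `IsGibbsMeasure.integral_eq_integral_kernel` (VEFS Prop. 2.7(c)); `[T2Space G]`,
  `[SecondCountableTopology G]` from the faithful continuous matrix representation `r` (closed
  embedding of compact `G` into `M_N(ℂ)`). The law of total covariance is three lines from (T).
* `stub_windowRarity` (R; M–L, THE new content) — `BackgroundBudget`-shaped: for compact simple `G`,
  faithful `r`, IF `f_r(β) + (3D/2) log β` converges THEN `∀ θ ∈ (0, 1/16], ∀ δ > 0, ∃ β₁, ∀ β ≥ β₁,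
  ∀ μ ∈ infiniteVolumeLimitPoints r.ρ β`, `μ(goodᶜ) ≤ δ/β²` (`good`, `Λ` verbatim as in the crux's
  hypotheses). Plan: union bound over the `O(β^(4θ))` plaquettes touching `Λ`, exponential Chebyshev
  `μ(E_p > β^(−15/16)) ≤ e^(−tβ^(1/16)) E_μ[e^(tβE_p)]`, Fröhlich–Lieb chessboard exponential-moment
  bound made `O(1)` by the SHARP free energy, on tori then on limit states (Portmanteau, `goodᶜ` open).
  Why it might fail: chessboard is in tree/print for EVEN tori (`chessboard_pow_le_even`; FILS 1978
  Thm 4.1; Friedli–Velenik Rem. 10.4) while limit points run over all sides `L_k + 1`; odd sides need the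
  mixed site/link reflection (`wilsonExpectation_oddReflectionPositive`, odd `L ≥ 3`) or another device —
  the SAME caveat the route records for `BackgroundBudget` (b)/(c).
* `stub_fixedDistanceWindow` (L; M) — (T) → (R) → `FreeEnergyLogCoefficient → BoxLaplace →
  BackgroundBudget → FixedDistanceLower`: total covariance; on `S = {γ_ω(good) ≥ 1/2}` swap `γ_ω ↔ ν_ω`
  at cost `6N² γ_ω(goodᶜ)` and apply `BoxLaplace` (i) with `C⁺ = max C 0`, off `S` use `|Cov| ≤ 2N²` and
  `BackgroundBudget` (c); `E_μ γ_ω(goodᶜ) = μ(goodᶜ) ≤ δ/β²` by (T)+(R); `E_μ D⁺ ≤ √δ/β`,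
  `E_μ (D₀⁺+D_x⁺)² ≤ 4δ/β²` by `BackgroundBudget` (a)(b); `|Cov_μ(m₀, m_x)| ≤ 2δ/β² + 32N² μ(goodᶜ)`
  (centre `m_y` at the flat-box conditioned mean); `δ = δ(n, A, C, N)` after `n`, then `β₁(n)`
  (`n ≤ ⌈β^θ⌉₊/2`, `C⁺β^(−δ') ≤ A/(4n⁸)`); Borel transport (`BorelSpace.measurable_eq`) feeds
  `FreeEnergyLogCoefficient` into the free-energy hypotheses of `BackgroundBudget` and (R).
* `stub_varianceWindow` (U; S–M) — (T) → (R) → `… → PlaquetteVarianceUpper`: total variance at `x = 0`,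
  `BoxLaplace` (ii) at `n = n₀` on `S`, `Var ≤ N²` off `S`, `Var_μ(m₀) ≤ 2δ/β² + 32N² μ(goodᶜ)`, `δ = 1`.

Hardest stub: R. Load-bearing: all four (T, R feed L and U; L and U are the two conjuncts). Conversely
L and U are trivial consequences of the crux (its two halves under two extra hypotheses) — as in every
split of a conjunction — while T and R are not.

## Audit (registrar folder `bc/`; raw outputs in `Lines/birth.md`)

`lean check --json` on this file: rc 0, errors [], sorries 4 = stubs 4 (`stub_dlrDisintegration`,
`stub_windowRarity`, `stub_fixedDistanceWindow`, `stub_varianceWindow`), zero elsewhere;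
`#print axioms WindowReduction_of` = {propext, sorryAx, Classical.choice, Quot.sound} (sorryAx from the
four stubs only; the explicit-hypothesis `example` at the end is the same glue with no stub in it).
BC3 probes (`bc/WindowReduction_probe.lean`, `…_pertactic.lean`; context = the route file, stubs NOT in
scope): for each stub statement `S`, `S → WindowReduction` and `S → YangMills` by
`first | exact? | simpa | simpa [S] | (unfold S; simpa) | aesop` (maxHeartbeats 400000) FAIL 8/8
(unsolved goals / aesop exhaustive-search failure / heartbeat timeout), and per tactic `exact?` ×8
("could not close the goal"), `aesop` ×8 (failed) — 16/16; converses `WindowReduction → S`,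
`YangMills → S` fail 8/8 by the same battery (informational). No stub is cheaply the crux or the summit.

Disproof used: none exists — `ledger crux ls stmt-QuantumFields-12317` shows no workfiles (no
`Disproof.lean`, no `Negative/` lemmas) at registration; negatives index (`ledger negatives --problem
QuantumFields`, 5 entries: RobustYangMillsRG, DiagonalMirrorRP, AdaptiveCoarseSystem, MultibosonLatticeGap,
AdmissibleRootsExist) has nothing near a DLR / large-field-rarity statement.
-/

noncomputable section

namespace Summit.QuantumFields.YangMills.Cruxes.WindowReduction.Birth

open MeasureTheory ProbabilityTheory Filter Topology
open Literature.MathematicalPhysics.QuantumFieldTheory (LatticeRep IsCompactSimpleLieGroup)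
open Literature.MathematicalPhysics.QuantumLattice
open Literature.Probability.LatticeModels
open Summit.QuantumFields.YangMills.Theses.DirichletWindow

/-! ## The four statements, named (documentation; each registered stub below spells its body out
verbatim over tree declarations, and the `example`s after the stubs check the two agree) -/

/-- **(T) DLR disintegration of torus-limit states over the exterior of a finite edge set** (kernel
form). For every `μ ∈ infiniteVolumeLimitPoints r.ρ β` and every finite `Λ`: Wilson's DLR kernels
`γ_Λ(· | ω) = ymSpecification r.ρ β Λ ω` are probability measures; `ω ↦ γ_Λ(A | ω)` is measurable and
`∫ γ_Λ(A | ω) dμ(ω) = μ(A)` (the DLR equation); and for every bounded measurable real observable `F`,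
`ω ↦ ∫ F dγ_Λ(· | ω)` is measurable with `∫ (∫ F dγ_Λ(· | ω)) dμ(ω) = ∫ F dμ`. The law of total
covariance `Cov_μ(P₀, P_x) = E_μ[Cov_γ_ω(P₀, P_x)] + Cov_μ(m₀, m_x)`, `m_y(ω) = E_γ_ω[P_y]`, is three
lines from this. Inputs, all in the tree: `mem_ymGibbsMeasures_of_mem_infiniteVolumeLimitPoints_holds`
(Georgii 2011 Thm 4.17), `isSpecification_ymSpecification_t2_holds` (Georgii Def. 2.9/Prop. 2.5), whose
`[T2Space G] [SecondCountableTopology G]` follow from the faithful continuous matrix representation `r`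
(closed embedding of the compact `G` into `M_N(ℂ)`); Mathlib `Measure.bind` / `Kernel` integration. -/
def DLRDisintegration : Prop :=
  ∀ (G : Type) [Group G] [TopologicalSpace G] [IsTopologicalGroup G] [CompactSpace G]
    [MeasurableSpace G] [BorelSpace G] (r : LatticeRep G) (β : ℝ),
    ∀ μ ∈ infiniteVolumeLimitPoints (d := 4) r.ρ β, ∀ Λ : Finset (ZdEdge 4),
      (∀ ω : LGConfig 4 G, IsProbabilityMeasure (ymSpecification r.ρ β Λ ω)) ∧
      (∀ A : Set (LGConfig 4 G), MeasurableSet A →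
        Measurable (fun ω : LGConfig 4 G => ymSpecification r.ρ β Λ ω A) ∧
        ∫⁻ ω, ymSpecification r.ρ β Λ ω A ∂μ = μ A) ∧
      (∀ F : LGConfig 4 G → ℝ, Measurable F → ∀ M : ℝ, (∀ U, |F U| ≤ M) →
        Measurable (fun ω : LGConfig 4 G => ∫ U, F U ∂(ymSpecification r.ρ β Λ ω)) ∧
        ∫ ω, (∫ U, F U ∂(ymSpecification r.ρ β Λ ω)) ∂μ = ∫ U, F U ∂μ)

/-- **(R) Large-field rarity in the Dirichlet window, for EVERY torus-limit state** — the export the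
crux's bookkeeping needs and none of its three hypotheses supplies (refuter rattack-12317 / rreview
0815T18-27 / grounder g27-20, 2026-08-15: `BackgroundBudget` (c) bounds only `μ{ω | γ_ω(good) < 1/2}`).
Shape = `BackgroundBudget`'s own quantifier prefix (sharp free energy as a per-`(G, r)` hypothesis,
`θ ∈ (0, 1/16]`, `δ > 0`, then `β₁`), conclusion = the repaired conjunct (c′) of the refuter's `W2.lean`:
`μ(goodᶜ) ≤ δ/β²`, `good` = every plaquette touching `Λ = box 4 ⌈β^θ⌉₊ ×ˢ univ` has
`N − Re tr r(U_p) ≤ β^(−15/16)`. Plan: union bound over the `≤ 6(2⌈β^θ⌉₊+3)⁴` plaquettes touching `Λ`,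
single-plaquette exponential Chebyshev `μ(E_p > τ) ≤ e^(−tβτ) E_μ[e^(tβE_p)]` with the Fröhlich–Lieb /
FILS chessboard exponential-moment bound `E[e^(tβE_p)] ≤ exp(f(β(1−t)) − f(β) + o(1))^(1/6)`-type, which is
`O(1)` by the SHARP free energy (the hypothesis), on the tori and then on limit states (`goodᶜ` is open:
Portmanteau). Why it might fail: chessboard estimates are printed for EVEN tori (FILS 1978 Thm 4.1; FV
Rem. 10.4) while `infiniteVolumeLimitPoints` runs over all sides `L_k + 1`; odd sides need the mixed
site/link reflections (tree `wilsonExpectation_oddReflectionPositive`) or another device. -/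
def WindowRarity : Prop :=
  ∀ (G : Type) [Group G] [TopologicalSpace G] [IsTopologicalGroup G] [CompactSpace G]
    [MeasurableSpace G] [BorelSpace G], IsCompactSimpleLieGroup G → ∀ r : LatticeRep G,
    (∃ K : ℝ, Tendsto (fun β : ℝ => freeEnergyDensity 4 r.ρ β +
      (3 * (Module.finrank ℝ ↥(Submodule.span ℝ {X : Matrix (Fin r.N) (Fin r.N) ℂ |
        ∀ t : ℝ, NormedSpace.exp ((t : ℂ) • X) ∈ Set.range r.ρ}) : ℝ) / 2) * Real.log β)
      atTop (nhds K)) →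
    ∀ θ : ℝ, 0 < θ → θ ≤ 1 / 16 → ∀ δ : ℝ, 0 < δ → ∃ β₁ : ℝ, ∀ β : ℝ, β₁ ≤ β →
      ∀ μ ∈ infiniteVolumeLimitPoints (d := 4) r.ρ β,
        μ ({U : LGConfig 4 G | ∀ p ∈ plaquettesTouching
            (box 4 ⌈β ^ θ⌉₊ ×ˢ (Finset.univ : Finset (Fin 4))),
            (r.N : ℝ) - plaquetteObs r.ρ p.1 p.2.1.1 p.2.1.2 U ≤ β ^ (-(15 : ℝ) / 16)}ᶜ) ≤
          ENNReal.ofReal (δ / β ^ 2)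

/-- **(L) The fixed-distance half of the window bookkeeping**: given (T) and (R), the crux's three
hypotheses give `FixedDistanceLower` (first conjunct of `LocalGaussianity`). Content: total covariance
(from T) `f_β(ne₀) = E_μ[Cov_γ_ω] + Cov_μ(m₀, m_x)`; on `S = {γ_ω(good) ≥ 1/2}` swap `γ_ω` for
`ν_ω = γ_ω(· | good)` at cost `6N²·γ_ω(goodᶜ)` and apply `BoxLaplace` (i) with `C⁺ = max C 0`; off `S`
use `|Cov| ≤ 2N²` and `BackgroundBudget` (c); `E_μ[γ_ω(goodᶜ)] = μ(goodᶜ) ≤ δ/β²` by (T)+(R);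
`E_μ[D⁺] ≤ (E_μ D²)^(1/2) ≤ √δ/β` and `E_μ[(D₀⁺+D_x⁺)²] ≤ 4δ/β²` by `BackgroundBudget` (a)(b);
`|Cov_μ(m₀, m_x)| ≤ max_y E_μ[(m_y − E_ν₁ P_y)²] ≤ 2δ/β² + 32N² μ(goodᶜ)`; choose `δ = δ(n, A, C, N)`
after `n`, then `β₁(n)` (also forcing `n ≤ ⌈β^θ⌉₊/2` and `C⁺β^(−δ') ≤ A/(4n⁸)`): `f_β(ne₀) ≥ A/(β²n⁸)`.
`FreeEnergyLogCoefficient` feeds the free-energy hypothesis of `BackgroundBudget` and of (R) after Borel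
transport (`BorelSpace.measurable_eq`, `subst`). -/
def FixedDistanceHalf : Prop :=
  DLRDisintegration → WindowRarity →
    FreeEnergyLogCoefficient → BoxLaplace → BackgroundBudget → FixedDistanceLower

/-- **(U) The variance half of the window bookkeeping**: given (T) and (R), the crux's three hypotheses
give `PlaquetteVarianceUpper` (second conjunct of `LocalGaussianity`). Content: total variance at `x = 0`,
`f_β(0) = E_μ[Var_γ_ω P₀] + Var_μ(m₀)`; `BoxLaplace` (ii) at `n = n₀` on `S`, `Var ≤ N²` off `S`;
`Var_μ(m₀) ≤ 2δ/β² + 32N² μ(goodᶜ)`; with `δ = 1`: `f_β(0) ≤ B'/β²`,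
`B' = B + 2C⁺ + 42N² + 2` (say). -/
def VarianceHalf : Prop :=
  DLRDisintegration → WindowRarity →
    FreeEnergyLogCoefficient → BoxLaplace → BackgroundBudget → PlaquetteVarianceUpper

/-! ## Registered stubs (signatures spelled out over tree declarations) -/

/-- Stub T (S–M, provable now) = `DLRDisintegration`: the DLR kernel toolkit for torus-limit states
(probability, set-DLR with measurability, function-DLR with measurability). -/
theorem stub_dlrDisintegration :
    ∀ (G : Type) [Group G] [TopologicalSpace G] [IsTopologicalGroup G] [CompactSpace G]
      [MeasurableSpace G] [BorelSpace G] (r : LatticeRep G) (β : ℝ),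
      ∀ μ ∈ infiniteVolumeLimitPoints (d := 4) r.ρ β, ∀ Λ : Finset (ZdEdge 4),
        (∀ ω : LGConfig 4 G, IsProbabilityMeasure (ymSpecification r.ρ β Λ ω)) ∧
        (∀ A : Set (LGConfig 4 G), MeasurableSet A →
          Measurable (fun ω : LGConfig 4 G => ymSpecification r.ρ β Λ ω A) ∧
          ∫⁻ ω, ymSpecification r.ρ β Λ ω A ∂μ = μ A) ∧
        (∀ F : LGConfig 4 G → ℝ, Measurable F → ∀ M : ℝ, (∀ U, |F U| ≤ M) →
          Measurable (fun ω : LGConfig 4 G => ∫ U, F U ∂(ymSpecification r.ρ β Λ ω)) ∧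
          ∫ ω, (∫ U, F U ∂(ymSpecification r.ρ β Λ ω)) ∂μ = ∫ U, F U ∂μ) := by
  sorry

/-- Stub R (M–L, the new content) = `WindowRarity`: `μ(goodᶜ) ≤ δ/β²` for every torus-limit state,
given the sharp free energy. -/
theorem stub_windowRarity :
    ∀ (G : Type) [Group G] [TopologicalSpace G] [IsTopologicalGroup G] [CompactSpace G]
      [MeasurableSpace G] [BorelSpace G], IsCompactSimpleLieGroup G → ∀ r : LatticeRep G,
      (∃ K : ℝ, Tendsto (fun β : ℝ => freeEnergyDensity 4 r.ρ β +
        (3 * (Module.finrank ℝ ↥(Submodule.span ℝ {X : Matrix (Fin r.N) (Fin r.N) ℂ |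
          ∀ t : ℝ, NormedSpace.exp ((t : ℂ) • X) ∈ Set.range r.ρ}) : ℝ) / 2) * Real.log β)
        atTop (nhds K)) →
      ∀ θ : ℝ, 0 < θ → θ ≤ 1 / 16 → ∀ δ : ℝ, 0 < δ → ∃ β₁ : ℝ, ∀ β : ℝ, β₁ ≤ β →
        ∀ μ ∈ infiniteVolumeLimitPoints (d := 4) r.ρ β,
          μ ({U : LGConfig 4 G | ∀ p ∈ plaquettesTouching
              (box 4 ⌈β ^ θ⌉₊ ×ˢ (Finset.univ : Finset (Fin 4))),
              (r.N : ℝ) - plaquetteObs r.ρ p.1 p.2.1.1 p.2.1.2 U ≤ β ^ (-(15 : ℝ) / 16)}ᶜ) ≤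
            ENNReal.ofReal (δ / β ^ 2) := by
  sorry

/-- Stub L (M) = `FixedDistanceHalf`: (T) → (R) → `FreeEnergyLogCoefficient → BoxLaplace →
BackgroundBudget → FixedDistanceLower`. -/
theorem stub_fixedDistanceWindow :
    (∀ (G : Type) [Group G] [TopologicalSpace G] [IsTopologicalGroup G] [CompactSpace G]
      [MeasurableSpace G] [BorelSpace G] (r : LatticeRep G) (β : ℝ),
      ∀ μ ∈ infiniteVolumeLimitPoints (d := 4) r.ρ β, ∀ Λ : Finset (ZdEdge 4),
        (∀ ω : LGConfig 4 G, IsProbabilityMeasure (ymSpecification r.ρ β Λ ω)) ∧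
        (∀ A : Set (LGConfig 4 G), MeasurableSet A →
          Measurable (fun ω : LGConfig 4 G => ymSpecification r.ρ β Λ ω A) ∧
          ∫⁻ ω, ymSpecification r.ρ β Λ ω A ∂μ = μ A) ∧
        (∀ F : LGConfig 4 G → ℝ, Measurable F → ∀ M : ℝ, (∀ U, |F U| ≤ M) →
          Measurable (fun ω : LGConfig 4 G => ∫ U, F U ∂(ymSpecification r.ρ β Λ ω)) ∧
          ∫ ω, (∫ U, F U ∂(ymSpecification r.ρ β Λ ω)) ∂μ = ∫ U, F U ∂μ)) →
    (∀ (G : Type) [Group G] [TopologicalSpace G] [IsTopologicalGroup G] [CompactSpace G]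
      [MeasurableSpace G] [BorelSpace G], IsCompactSimpleLieGroup G → ∀ r : LatticeRep G,
      (∃ K : ℝ, Tendsto (fun β : ℝ => freeEnergyDensity 4 r.ρ β +
        (3 * (Module.finrank ℝ ↥(Submodule.span ℝ {X : Matrix (Fin r.N) (Fin r.N) ℂ |
          ∀ t : ℝ, NormedSpace.exp ((t : ℂ) • X) ∈ Set.range r.ρ}) : ℝ) / 2) * Real.log β)
        atTop (nhds K)) →
      ∀ θ : ℝ, 0 < θ → θ ≤ 1 / 16 → ∀ δ : ℝ, 0 < δ → ∃ β₁ : ℝ, ∀ β : ℝ, β₁ ≤ β →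
        ∀ μ ∈ infiniteVolumeLimitPoints (d := 4) r.ρ β,
          μ ({U : LGConfig 4 G | ∀ p ∈ plaquettesTouching
              (box 4 ⌈β ^ θ⌉₊ ×ˢ (Finset.univ : Finset (Fin 4))),
              (r.N : ℝ) - plaquetteObs r.ρ p.1 p.2.1.1 p.2.1.2 U ≤ β ^ (-(15 : ℝ) / 16)}ᶜ) ≤
            ENNReal.ofReal (δ / β ^ 2)) →
    FreeEnergyLogCoefficient → BoxLaplace → BackgroundBudget → FixedDistanceLower := by
  sorry

/-- Stub U (S–M) = `VarianceHalf`: (T) → (R) → `FreeEnergyLogCoefficient → BoxLaplace →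
BackgroundBudget → PlaquetteVarianceUpper`. -/
theorem stub_varianceWindow :
    (∀ (G : Type) [Group G] [TopologicalSpace G] [IsTopologicalGroup G] [CompactSpace G]
      [MeasurableSpace G] [BorelSpace G] (r : LatticeRep G) (β : ℝ),
      ∀ μ ∈ infiniteVolumeLimitPoints (d := 4) r.ρ β, ∀ Λ : Finset (ZdEdge 4),
        (∀ ω : LGConfig 4 G, IsProbabilityMeasure (ymSpecification r.ρ β Λ ω)) ∧
        (∀ A : Set (LGConfig 4 G), MeasurableSet A →
          Measurable (fun ω : LGConfig 4 G => ymSpecification r.ρ β Λ ω A) ∧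
          ∫⁻ ω, ymSpecification r.ρ β Λ ω A ∂μ = μ A) ∧
        (∀ F : LGConfig 4 G → ℝ, Measurable F → ∀ M : ℝ, (∀ U, |F U| ≤ M) →
          Measurable (fun ω : LGConfig 4 G => ∫ U, F U ∂(ymSpecification r.ρ β Λ ω)) ∧
          ∫ ω, (∫ U, F U ∂(ymSpecification r.ρ β Λ ω)) ∂μ = ∫ U, F U ∂μ)) →
    (∀ (G : Type) [Group G] [TopologicalSpace G] [IsTopologicalGroup G] [CompactSpace G]
      [MeasurableSpace G] [BorelSpace G], IsCompactSimpleLieGroup G → ∀ r : LatticeRep G,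
      (∃ K : ℝ, Tendsto (fun β : ℝ => freeEnergyDensity 4 r.ρ β +
        (3 * (Module.finrank ℝ ↥(Submodule.span ℝ {X : Matrix (Fin r.N) (Fin r.N) ℂ |
          ∀ t : ℝ, NormedSpace.exp ((t : ℂ) • X) ∈ Set.range r.ρ}) : ℝ) / 2) * Real.log β)
        atTop (nhds K)) →
      ∀ θ : ℝ, 0 < θ → θ ≤ 1 / 16 → ∀ δ : ℝ, 0 < δ → ∃ β₁ : ℝ, ∀ β : ℝ, β₁ ≤ β →
        ∀ μ ∈ infiniteVolumeLimitPoints (d := 4) r.ρ β,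
          μ ({U : LGConfig 4 G | ∀ p ∈ plaquettesTouching
              (box 4 ⌈β ^ θ⌉₊ ×ˢ (Finset.univ : Finset (Fin 4))),
              (r.N : ℝ) - plaquetteObs r.ρ p.1 p.2.1.1 p.2.1.2 U ≤ β ^ (-(15 : ℝ) / 16)}ᶜ) ≤
            ENNReal.ofReal (δ / β ^ 2)) →
    FreeEnergyLogCoefficient → BoxLaplace → BackgroundBudget → PlaquetteVarianceUpper := by
  sorry

/-! ## The named statements ARE the registered signatures (definitional unfolding, no `sorry` added) -/

example : DLRDisintegration = (∀ (G : Type) [Group G] [TopologicalSpace G] [IsTopologicalGroup G] [CompactSpace G]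
      [MeasurableSpace G] [BorelSpace G] (r : LatticeRep G) (β : ℝ),
      ∀ μ ∈ infiniteVolumeLimitPoints (d := 4) r.ρ β, ∀ Λ : Finset (ZdEdge 4),
        (∀ ω : LGConfig 4 G, IsProbabilityMeasure (ymSpecification r.ρ β Λ ω)) ∧
        (∀ A : Set (LGConfig 4 G), MeasurableSet A →
          Measurable (fun ω : LGConfig 4 G => ymSpecification r.ρ β Λ ω A) ∧
          ∫⁻ ω, ymSpecification r.ρ β Λ ω A ∂μ = μ A) ∧
        (∀ F : LGConfig 4 G → ℝ, Measurable F → ∀ M : ℝ, (∀ U, |F U| ≤ M) →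
          Measurable (fun ω : LGConfig 4 G => ∫ U, F U ∂(ymSpecification r.ρ β Λ ω)) ∧
          ∫ ω, (∫ U, F U ∂(ymSpecification r.ρ β Λ ω)) ∂μ = ∫ U, F U ∂μ)) := rfl

example : WindowRarity = (∀ (G : Type) [Group G] [TopologicalSpace G] [IsTopologicalGroup G] [CompactSpace G]
      [MeasurableSpace G] [BorelSpace G], IsCompactSimpleLieGroup G → ∀ r : LatticeRep G,
      (∃ K : ℝ, Tendsto (fun β : ℝ => freeEnergyDensity 4 r.ρ β +
        (3 * (Module.finrank ℝ ↥(Submodule.span ℝ {X : Matrix (Fin r.N) (Fin r.N) ℂ |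
          ∀ t : ℝ, NormedSpace.exp ((t : ℂ) • X) ∈ Set.range r.ρ}) : ℝ) / 2) * Real.log β)
        atTop (nhds K)) →
      ∀ θ : ℝ, 0 < θ → θ ≤ 1 / 16 → ∀ δ : ℝ, 0 < δ → ∃ β₁ : ℝ, ∀ β : ℝ, β₁ ≤ β →
        ∀ μ ∈ infiniteVolumeLimitPoints (d := 4) r.ρ β,
          μ ({U : LGConfig 4 G | ∀ p ∈ plaquettesTouching
              (box 4 ⌈β ^ θ⌉₊ ×ˢ (Finset.univ : Finset (Fin 4))),
              (r.N : ℝ) - plaquetteObs r.ρ p.1 p.2.1.1 p.2.1.2 U ≤ β ^ (-(15 : ℝ) / 16)}ᶜ) ≤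
            ENNReal.ofReal (δ / β ^ 2)) := rfl

example : DLRDisintegration := stub_dlrDisintegration
example : WindowRarity := stub_windowRarity
example : FixedDistanceHalf := stub_fixedDistanceWindow
example : VarianceHalf := stub_varianceWindow

/-! ## The composition (kernel-checked; no `sorry` outside the stubs) -/

/-- **The skeleton closes the crux modulo its stubs** (registered form, as `ledger skeleton check`
requires: conclusion = the crux BY NAME, no hypotheses, the four stubs used BY NAME):
`WindowReduction := FreeEnergyLogCoefficient → BoxLaplace → BackgroundBudget → LocalGaussianity` and
`LocalGaussianity` is by definition the conjunction of the bodies of `FixedDistanceLower` and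
`PlaquetteVarianceUpper`, supplied by stubs L and U fed with stubs T and R. -/
theorem WindowReduction_of : WindowReduction := by
  intro hFE hBL hBB
  exact ⟨stub_fixedDistanceWindow stub_dlrDisintegration stub_windowRarity hFE hBL hBB,
    stub_varianceWindow stub_dlrDisintegration stub_windowRarity hFE hBL hBB⟩

/-- **The glue alone, `sorry`-free**: the four stub statements as explicit hypotheses (by their
documentation names, definitionally the registered signatures — see the `rfl` examples) imply the crux
BY NAME. This `example` does not mention the stubs, so any `sorry` in it would be flagged; there is none.
(Stubs L and U are, conversely, trivial consequences of the crux — they are its two halves under two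
extra hypotheses; T and R are not.) -/
example (hT : DLRDisintegration) (hR : WindowRarity) (hL : FixedDistanceHalf) (hU : VarianceHalf) :
    WindowReduction :=
  fun hFE hBL hBB => ⟨hL hT hR hFE hBL hBB, hU hT hR hFE hBL hBB⟩

end Summit.QuantumFields.YangMills.Cruxes.WindowReduction.Birth

end
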